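import Mathlib
import Summits.Parity.GeneralizedHardyLittlewood.Theorems.PrimeGapTorusCapPart4
import HarnessLib

/-!
# Prime-gap limit points, the torus cap (cell parity-ideate, p4 ROUND-12) — part 5/8 (`coeff_gProd_eq` … `delannoy_cast_eq`)

Source: `HOME/parity-ideate-p4/round12/Sketch16.lean` (sha16 e5770481db81479a, 7 278 lines, farm rc 0 / 0 sorry /
axioms std-3; namespace `ParityIdeateP4R8`), cut by parity-ideate-lit g32 (`ports/toruscap/build_toruscap.py`) to the
dependency cone (143 declarations) of the eight headline declarations `torusCap_iff`, `torusCapBrauer_iff`,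
`torusCap_half`, `cb1_holds`, `conjHalfStrict_holds`, `NearAP.delannoyNonVanishing_holds`, `capGivesCoverage`,
`residueCoverage_half_of_literature`, in a chain of 8 files of ≤ 400 lines (Theorems-side lint); statements byte-identical
to the source except: `NearAP.P0/P1/P2` are `abbrev` (source: `def` + three `Decidable` instances, dropped per the typing
lint), examples and `decide` rungs outside the cone dropped, namespace `ParityIdeateP4R8` ↦ `Summit.Parity.GeneralizedHardyLittlewood.Theorems.PrimeGapTorusCap`.
Non-Mathlib inputs: `Literature.Combinatorics.Additive.ErdosHeilbronn` (combinatorial Nullstellensatz),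
`Literature.NumberTheory.Sieve.PrimeGapLimitPoints` (`primeGapLimitSet`, `HasPointProperty`, the NAMED fact
`Merikoski2020_theorem1`, used hypothesis-style, never asserted).  No `sorry`, no new axioms, no `instance`, no notation.
Cell-original mathematics (FRONTIER formalisation; nothing here bears on the parity problem beyond the typed statements):
CONJECTURE C of the cell = every measurable `perℤ`-periodic four-point-free `U ⊆ ℝ` has `μ(U ∩ [0,per)) ≤ per/2`,
sharp (mid arc); pay-off: residues of the prime-gap limit-point set `𝓛` modulo `λ` cover ≥ half of `[0, λ)` for every
`λ > 0`, given Merikoski's four-point theorem.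
-/

namespace Summit.Parity.GeneralizedHardyLittlewood.Theorems.PrimeGapTorusCap.NearAP
variable {N : ℕ}
section anrprep
open MvPolynomial Literature.Combinatorics.Additive Literature.Combinatorics.Additive.ErdosHeilbronn
variable {R : Type*} [CommRing R] [Nontrivial R] [DecidableEq R]

omit [Nontrivial R] in
/-- Same with an arbitrary linear form `M` (total degree ≤ 1) in the product and an arbitrary cofactor `g`:
the top-degree coefficients of `g · ∏_{c∈C}(M - c)` are those of `g · M^{|C|}`. -/
theorem coeff_gProd_eq (M : MvPolynomial (Fin 2) R) (hM : M.totalDegree ≤ 1) (C : Finset R) :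
    ∀ (g : MvPolynomial (Fin 2) R) (d : Fin 2 →₀ ℕ), g.totalDegree + C.card ≤ d.degree →
      coeff d (g * ∏ c ∈ C, (M - MvPolynomial.C c)) = coeff d (g * M ^ C.card) := by
  induction C using Finset.induction_on with
  | empty => intro g d _; simp
  | insert c C hc ih =>
    intro g d hd
    rw [Finset.prod_insert hc, Finset.card_insert_of_notMem hc] at *
    have hsplit : g * ((M - MvPolynomial.C c) * ∏ x ∈ C, (M - MvPolynomial.C x)) =
        (g * M) * ∏ x ∈ C, (M - MvPolynomial.C x) - MvPolynomial.C c * (g * ∏ x ∈ C, (M - MvPolynomial.C x)) := by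
      ring
    have hgM : (g * M).totalDegree ≤ g.totalDegree + 1 := (totalDegree_mul g M).trans (by omega)
    rw [hsplit, coeff_sub, coeff_C_mul, ih (g * M) d (by omega)]
    have hle : ∀ x : R, (M - MvPolynomial.C x).totalDegree ≤ 1 := fun x =>
      (totalDegree_sub _ _).trans (by rw [totalDegree_C, Nat.max_zero]; exact hM)
    have hprod : (∏ x ∈ C, (M - MvPolynomial.C x)).totalDegree ≤ C.card := by
      calc (∏ x ∈ C, (M - MvPolynomial.C x)).totalDegree ≤ ∑ x ∈ C, (M - MvPolynomial.C x).totalDegree :=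
            totalDegree_finsetProd _ _
        _ ≤ ∑ _x ∈ C, 1 := by gcongr with x _; exact hle x
        _ = C.card := by simp
    have hlow : coeff d (g * ∏ x ∈ C, (M - MvPolynomial.C x)) = 0 := by
      apply coeff_eq_zero_of_totalDegree_lt
      rw [← Finsupp.degree_apply]
      have h2 := totalDegree_mul g (∏ x ∈ C, (M - MvPolynomial.C x))
      omega
    rw [hlow, mul_zero, sub_zero, show g * M * M ^ C.card = g * M ^ (C.card + 1) by ring]

/-- (β1) Alon–Nathanson–Ruzsa with a general polynomial weight `h` (n = 2): if
`deg h + K + 2 ≤ |A| + |B|` and the `x^{|A|-1} y^{|B|-1}` coefficient of `h · (x+y)^K` is nonzero, then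
`|{a + b : a ∈ A, b ∈ B, h(a,b) ≠ 0}| ≥ K + 1`.  [Tao–Vu, Additive Combinatorics, Lemma 9.3; AlonNathansonRuzsa1996 Prop. 1.2]
Proof = `Literature.Combinatorics.Additive.card_restrictedSumset_ge_core` with `(x - y)` replaced by `h`. -/
theorem anr_general_h {p : ℕ} [hp : Fact p.Prime] {A B : Finset (ZMod p)} (h : MvPolynomial (Fin 2) (ZMod p)) (K : ℕ)
    (hA : A.Nonempty) (hB : B.Nonempty)
    (hdeg : h.totalDegree + K + 2 ≤ A.card + B.card)
    (hcoeff : coeff (mono (A.card - 1) (B.card - 1)) (h * (L : MvPolynomial (Fin 2) (ZMod p)) ^ K) ≠ 0) :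
    K + 1 ≤ (((A ×ˢ B).filter (fun ab => eval ![ab.1, ab.2] h ≠ 0)).image (fun ab => ab.1 + ab.2)).card := by
  set E := ((A ×ˢ B).filter (fun ab => eval ![ab.1, ab.2] h ≠ 0)).image (fun ab => ab.1 + ab.2) with hE
  by_contra hcon
  push Not at hcon
  have hk : 1 ≤ A.card := hA.card_pos
  have hl : 1 ≤ B.card := hB.card_pos
  obtain ⟨r, hr⟩ : ∃ r, r + E.card = K := ⟨K - E.card, by omega⟩
  have hne : coeff (mono (A.card - 1) (B.card - 1))
      (h * ((L : MvPolynomial (Fin 2) (ZMod p)) ^ r * ∏ c ∈ E, (L - MvPolynomial.C c))) ≠ 0 := by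
    rw [coeff_hQ_eq h E r _ (by rw [mono_degree]; omega), hr]
    exact hcoeff
  have hdeg' : (h * ((L : MvPolynomial (Fin 2) (ZMod p)) ^ r * ∏ c ∈ E, (L - MvPolynomial.C c))).totalDegree =
      (mono (A.card - 1) (B.card - 1)).degree := by
    apply le_antisymm
    · rw [mono_degree]
      refine (totalDegree_mul _ _).trans ?_
      have h2 := totalDegree_Q_le (R := ZMod p) E r
      omega
    · have h' := le_totalDegree (mem_support_iff.2 hne)
      simpa only [Finsupp.sum, ← Finsupp.degree_apply] using h'
  have htS : ∀ i, (mono (A.card - 1) (B.card - 1)) i < (((![A, B] : Fin 2 → Finset (ZMod p)) i)).card := by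
    intro i
    fin_cases i
    · simp only [mono_apply_zero, Fin.zero_eta, Matrix.cons_val_zero]
      omega
    · simp only [mono_apply_one, Fin.mk_one, Matrix.cons_val_one, Matrix.cons_val_fin_one]
      omega
  obtain ⟨s, hs, hsf⟩ :=
    combinatorial_nullstellensatz_exists_eval_nonzero _ _ hne hdeg' ![A, B] htS
  apply hsf
  have hs0 : s 0 ∈ A := by simpa using hs 0
  have hs1 : s 1 ∈ B := by simpa using hs 1
  by_cases hh : eval s h = 0
  · rw [map_mul, hh, zero_mul]
  · have hsv : (![s 0, s 1] : Fin 2 → ZMod p) = s := by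
      ext i; fin_cases i <;> rfl
    have hc : s 0 + s 1 ∈ E :=
      Finset.mem_image.mpr ⟨(s 0, s 1), Finset.mem_filter.mpr ⟨Finset.mem_product.mpr ⟨hs0, hs1⟩, by rw [hsv]; exact hh⟩, rfl⟩
    simp only [map_mul, map_sub, map_pow, map_prod, map_add, eval_X, eval_C, L]
    rw [Finset.prod_eq_zero hc (by rw [sub_self]), mul_zero, mul_zero]

end anrprep
/-! ## (β2′) The explicit certificate coefficient and (β4) the assembly: `PolyRungStar` PROVED. -/

section coefcert
open MvPolynomial Finset
open Literature.Combinatorics.Additive Literature.Combinatorics.Additive.ErdosHeilbronn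
variable {R : Type*} [CommRing R]
/-- The coefficient of `x^m y^n` in `(x+y)^m (y-x)^n` is `Σ_j (-1)^j C(m,j) C(n,j)`. -/
theorem coeff_Lpow_mul_Dpow (m n : ℕ) :
    coeff (mono m n) (((X 0 + X 1) : MvPolynomial (Fin 2) R) ^ m * (X 1 - X 0) ^ n)
      = ∑ j ∈ range (m + 1), (-1) ^ j * (m.choose j : R) * (n.choose j : R) := by
  have e1 : ((X 0 + X 1) : MvPolynomial (Fin 2) R) ^ m
      = ∑ i ∈ range (m + 1), X 0 ^ i * X 1 ^ (m - i) * (m.choose i : MvPolynomial (Fin 2) R) := add_pow _ _ _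
  have e2 : ((X 1 - X 0) : MvPolynomial (Fin 2) R) ^ n
      = ∑ j ∈ range (n + 1), (-X 0) ^ j * X 1 ^ (n - j) * (n.choose j : MvPolynomial (Fin 2) R) := by
    rw [sub_eq_neg_add, add_pow]
  have hterm : ∀ i j : ℕ,
      (X 0 ^ i * X 1 ^ (m - i) * (m.choose i : MvPolynomial (Fin 2) R)) *
        ((-X 0) ^ j * X 1 ^ (n - j) * (n.choose j : MvPolynomial (Fin 2) R))
      = monomial (mono (i + j) (m - i + (n - j))) ((-1) ^ j * (m.choose i : R) * (n.choose j : R)) := by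
    intro i j
    have : (X 0 ^ i * X 1 ^ (m - i) * (m.choose i : MvPolynomial (Fin 2) R)) *
        ((-X 0) ^ j * X 1 ^ (n - j) * (n.choose j : MvPolynomial (Fin 2) R))
        = C ((-1) ^ j * (m.choose i : R) * (n.choose j : R)) * (X 0 ^ (i + j) * X 1 ^ (m - i + (n - j))) := by
      rw [map_mul, map_mul, map_natCast, map_natCast, map_pow, map_neg, map_one]
      ring
    rw [this, X_pow_mul_X_pow, C_mul_monomial, mul_one]
  rw [e1, e2, Finset.sum_mul_sum, coeff_sum]
  simp_rw [coeff_sum, hterm, coeff_monomial]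
  have hinner : ∀ i ∈ range (m + 1),
      (∑ j ∈ range (n + 1), if mono (i + j) (m - i + (n - j)) = mono m n
          then (-1 : R) ^ j * (m.choose i : R) * (n.choose j : R) else 0)
        = (-1 : R) ^ (m - i) * (m.choose i : R) * (n.choose (m - i) : R) := by
    intro i hi
    rw [mem_range] at hi
    by_cases hmi : m - i ≤ n
    · rw [Finset.sum_eq_single (m - i)]
      · rw [if_pos (by rw [mono_eq_iff]; omega)]
      · intro j hj hne
        rw [if_neg (by rw [mono_eq_iff]; omega)]
      · intro h
        exact absurd (mem_range.2 (by omega)) h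
    · rw [Finset.sum_eq_zero]
      · rw [Nat.choose_eq_zero_of_lt (not_le.mp hmi), Nat.cast_zero, mul_zero]
      · intro j hj
        rw [mem_range] at hj
        rw [if_neg (by rw [mono_eq_iff]; omega)]
  rw [Finset.sum_congr rfl hinner, ← Finset.sum_range_reflect]
  refine Finset.sum_congr rfl fun j hj => ?_
  rw [mem_range] at hj
  rw [show m + 1 - 1 - j = m - j by omega, show m - (m - j) = j by omega, Nat.choose_symm (by omega : j ≤ m)]

/-- With a scalar `c` on the second form and a trailing `y^d`:
coefficient of `x^m y^{n+d}` in `(x+y)^m (c(y-x))^n y^d` is `c^n Σ_j (-1)^j C(m,j) C(n,j)`. -/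
theorem coeff_cert (m n d : ℕ) (c : R) :
    coeff (mono m (n + d)) (((X 0 + X 1) : MvPolynomial (Fin 2) R) ^ m * (C c * (X 1 - X 0)) ^ n * X 1 ^ d)
      = c ^ n * ∑ j ∈ range (m + 1), (-1) ^ j * (m.choose j : R) * (n.choose j : R) := by
  rw [mul_pow, ← C_pow, show ((X 0 + X 1 : MvPolynomial (Fin 2) R)) ^ m * (C (c ^ n) * (X 1 - X 0) ^ n) * X 1 ^ d
      = C (c ^ n) * (((X 0 + X 1) ^ m * (X 1 - X 0) ^ n) * X 1 ^ d) by ring,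
    coeff_C_mul, X_pow_eq_monomial, coeff_mul_monomial']
  have hle : Finsupp.single (1 : Fin 2) d ≤ mono m (n + d) := by
    rw [Finsupp.le_def]; intro i; fin_cases i <;> simp [mono]
  have hsub : mono m (n + d) - Finsupp.single (1 : Fin 2) d = mono m n := by
    ext s; fin_cases s <;> simp [mono]
  rw [if_pos hle, mul_one, hsub, coeff_Lpow_mul_Dpow]

end coefcert
section assembly
open MvPolynomial Finset
open Literature.Combinatorics.Additive Literature.Combinatorics.Additive.ErdosHeilbronn
/-- `|S ∪ (S - 1)| = |S| + runCount S`. -/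
theorem card_union_shift {N : ℕ} [NeZero N] (S : Finset (ZMod N)) :
    (S ∪ S.image (fun x => x - 1)).card = S.card + runCount S := by
  have hdisj : Disjoint S ((S.image (fun x => x - 1)) \ S) := Finset.disjoint_sdiff
  rw [← Finset.union_sdiff_self_eq_union, Finset.card_union_of_disjoint hdisj]
  unfold runCount
  congr 1
  rw [show (S.image (fun x => x - 1)) \ S = (S.filter (fun s => s - 1 ∉ S)).image (fun x => x - 1) by
    ext y
    simp only [mem_sdiff, mem_image, mem_filter]
    constructor
    · rintro ⟨⟨x, hx, rfl⟩, hy⟩; exact ⟨x, ⟨hx, hy⟩, rfl⟩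
    · rintro ⟨x, ⟨hx, hy⟩, rfl⟩; exact ⟨⟨x, hx, rfl⟩, hy⟩]
  exact Finset.card_image_of_injective _ sub_left_injective

/-- **Theorem R★ in the kernel.**  At an odd prime `p`: `|S| = k ≤ p/2`, `runCount S ≥ p + 1 - 2k` and `p ∤ D_{k-1}`
imply `|D₃⁺ S| ≥ |S|`.  Proof: `anr_general_h` with `A = -S`, `B = S ∪ (S-1)`,
`h = ∏_{c ∉ S} ((y - x)/2 - c) · y^d`, `d = 2k + ρ - p - 1`, `K = k - 1`; the certificate coefficient is
`2^{-(p-k)} · D_{k-1}` (`coeff_gProd_eq`, `coeff_cert`, `anr_coeff_eq_delannoy`); admissible sums are doubled steps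
(`card_admissible_le`). -/
theorem polyRungStar_holds : PolyRungStar := by
  intro p hp hp2 S h2k hrun hD
  haveI : Fact p.Prime := ⟨hp⟩
  haveI : NeZero p := ⟨hp.ne_zero⟩
  have hp3 : 3 ≤ p := by have := hp.two_le; omega
  set k := S.card with hk
  have hrk : runCount S ≤ k := Finset.card_filter_le _ _
  have hk1 : 1 ≤ k := by omega
  have h2 : (2 : ZMod p) ≠ 0 := by
    intro h
    have h' : ((2 : ℕ) : ZMod p) = 0 := by exact_mod_cast h
    rw [ZMod.natCast_eq_zero_iff] at h'
    have := Nat.le_of_dvd (by norm_num) h'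
    omega
  -- the data
  have hA : (S.image (fun x => -x)).card = k := Finset.card_image_of_injective _ neg_injective
  have hB : (S ∪ S.image (fun x => x - 1)).card = k + runCount S := card_union_shift S
  have hSc : (Sᶜ).card = p - k := by rw [Finset.card_compl, ZMod.card]
  have hSne : S.Nonempty := Finset.card_pos.mp (by omega)
  have hAne : (S.image (fun x => -x)).Nonempty := hSne.image _
  have hBne : (S ∪ S.image (fun x => x - 1)).Nonempty := hSne.mono Finset.subset_union_left
  -- degrees
  have hM : (MvPolynomial.C (2⁻¹ : ZMod p) * (X 1 - X 0) : MvPolynomial (Fin 2) (ZMod p)).totalDegree ≤ 1 := by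
    refine (totalDegree_mul _ _).trans ?_
    rw [totalDegree_C, zero_add]
    exact (totalDegree_sub _ _).trans (by rw [totalDegree_X, totalDegree_X, max_self])
  have hprod : (∏ c ∈ Sᶜ, (MvPolynomial.C (2⁻¹ : ZMod p) * (X 1 - X 0) - MvPolynomial.C c) :
      MvPolynomial (Fin 2) (ZMod p)).totalDegree ≤ p - k := by
    rw [← hSc]
    calc (∏ c ∈ Sᶜ, (MvPolynomial.C (2⁻¹ : ZMod p) * (X 1 - X 0) - MvPolynomial.C c) :
            MvPolynomial (Fin 2) (ZMod p)).totalDegree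
          ≤ ∑ c ∈ Sᶜ, (MvPolynomial.C (2⁻¹ : ZMod p) * (X 1 - X 0) - MvPolynomial.C c :
            MvPolynomial (Fin 2) (ZMod p)).totalDegree := totalDegree_finsetProd _ _
      _ ≤ ∑ _c ∈ Sᶜ, 1 := by
            gcongr with c _
            exact (totalDegree_sub _ _).trans (by rw [totalDegree_C, Nat.max_zero]; exact hM)
      _ = (Sᶜ).card := by simp
  have hXd : ((X 1 : MvPolynomial (Fin 2) (ZMod p)) ^ (2 * k + runCount S - p - 1)).totalDegree
      = 2 * k + runCount S - p - 1 := totalDegree_X_pow _ _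
  have hLK : ((L : MvPolynomial (Fin 2) (ZMod p)) ^ (k - 1)).totalDegree ≤ k - 1 :=
    (totalDegree_pow _ _).trans (by simpa using Nat.mul_le_mul_left (k - 1) totalDegree_L_le)
  have hh : ((∏ c ∈ Sᶜ, (MvPolynomial.C (2⁻¹ : ZMod p) * (X 1 - X 0) - MvPolynomial.C c)) *
      (X 1 : MvPolynomial (Fin 2) (ZMod p)) ^ (2 * k + runCount S - p - 1)).totalDegree ≤ (p - k) + (2 * k + runCount S - p - 1) := by
    refine (totalDegree_mul _ _).trans ?_
    rw [hXd]; omega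
  -- ANR
  have hanr := anr_general_h (A := S.image (fun x => -x)) (B := S ∪ S.image (fun x => x - 1))
    ((∏ c ∈ Sᶜ, (MvPolynomial.C (2⁻¹ : ZMod p) * (X 1 - X 0) - MvPolynomial.C c)) *
      (X 1 : MvPolynomial (Fin 2) (ZMod p)) ^ (2 * k + runCount S - p - 1)) (k - 1) hAne hBne
    (by rw [hA, hB]; omega) ?_
  · rw [show k - 1 + 1 = k by omega] at hanr
    refine hanr.trans (card_admissible_le S _ ?_)
    intro e he
    obtain ⟨ab, hab, rfl⟩ := Finset.mem_image.mp he
    obtain ⟨hAB, hev⟩ := Finset.mem_filter.mp hab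
    obtain ⟨ha', hb⟩ := Finset.mem_product.mp hAB
    obtain ⟨a, haS, hax⟩ := Finset.mem_image.mp ha'
    have hbS : ab.2 ∈ S ∨ ab.2 + 1 ∈ S := by
      rcases Finset.mem_union.mp hb with h | h
      · exact Or.inl h
      · obtain ⟨s, hs, hsb⟩ := Finset.mem_image.mp h
        right; rw [← hsb, sub_add_cancel]; exact hs
    have hm : (2⁻¹ : ZMod p) * (ab.2 + a) ∈ S := by
      by_contra hmS
      have hc : (2⁻¹ : ZMod p) * (ab.2 + a) ∈ Sᶜ := Finset.mem_compl.mpr hmS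
      apply hev
      rw [map_mul, map_prod]
      have hz : eval ![ab.1, ab.2] (MvPolynomial.C (2⁻¹ : ZMod p) * (X 1 - X 0) - MvPolynomial.C ((2⁻¹ : ZMod p) * (ab.2 + a)) :
          MvPolynomial (Fin 2) (ZMod p)) = 0 := by
        simp only [map_sub, map_mul, eval_C, eval_X, Matrix.cons_val_zero, Matrix.cons_val_one, Matrix.cons_val_fin_one]
        rw [← hax]; ring
      rw [Finset.prod_eq_zero hc hz, zero_mul]
    refine ⟨a, (2⁻¹ : ZMod p) * (ab.2 + a), ab.2, haS, hm, hbS, ?_, ?_⟩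
    · have h22 : (2⁻¹ : ZMod p) * 2 = 1 := inv_mul_cancel₀ h2
      linear_combination (ab.2 + a) * h22
    · rw [← hax]; ring
  -- the certificate coefficient
  · rw [hA, hB]
    have eq1 : (∏ c ∈ Sᶜ, (MvPolynomial.C (2⁻¹ : ZMod p) * (X 1 - X 0) - MvPolynomial.C c)) *
        (X 1 : MvPolynomial (Fin 2) (ZMod p)) ^ (2 * k + runCount S - p - 1) * L ^ (k - 1)
        = ((X 1 : MvPolynomial (Fin 2) (ZMod p)) ^ (2 * k + runCount S - p - 1) * L ^ (k - 1)) *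
          ∏ c ∈ Sᶜ, (MvPolynomial.C (2⁻¹ : ZMod p) * (X 1 - X 0) - MvPolynomial.C c) := by ring
    have hg : ((X 1 : MvPolynomial (Fin 2) (ZMod p)) ^ (2 * k + runCount S - p - 1) * L ^ (k - 1)).totalDegree
        ≤ (2 * k + runCount S - p - 1) + (k - 1) := by
      refine (totalDegree_mul _ _).trans ?_
      rw [hXd]; omega
    rw [eq1, coeff_gProd_eq _ hM Sᶜ _ _ (by rw [mono_degree, hSc]; omega), hSc]
    have eq2 : ((X 1 : MvPolynomial (Fin 2) (ZMod p)) ^ (2 * k + runCount S - p - 1) * L ^ (k - 1)) *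
        (MvPolynomial.C (2⁻¹ : ZMod p) * (X 1 - X 0)) ^ (p - k)
        = (X 0 + X 1) ^ (k - 1) * (MvPolynomial.C (2⁻¹ : ZMod p) * (X 1 - X 0)) ^ (p - k) *
          (X 1 : MvPolynomial (Fin 2) (ZMod p)) ^ (2 * k + runCount S - p - 1) := by rw [L]; ring
    rw [eq2, show k + runCount S - 1 = (p - k) + (2 * k + runCount S - p - 1) by omega,
      coeff_cert (k - 1) (p - k) (2 * k + runCount S - p - 1) (2⁻¹ : ZMod p),
      show k - 1 + 1 = k by omega, anr_coeff_eq_delannoy k hk1 (by omega)]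
    refine mul_ne_zero (pow_ne_zero _ (inv_ne_zero h2)) ?_
    rw [Ne, ZMod.natCast_eq_zero_iff]
    intro hdvd
    exact hD (Nat.mod_eq_zero_of_dvd hdvd)

/-! ## Unconditional corollaries (ROUND-11 headline, kernel-checked) -/

/-- **Top slice at every prime `p ≥ 7`, conditional only on Theorem Q** (`p ∤ D_{(p-3)/2}`, desk-proved via the
Deuring polynomial; kernel-certified for `p < 200`). -/
theorem topSlice_all (hQ : DelannoyNonVanishing) (p : ℕ) (hp : p.Prime) (h7 : 7 ≤ p)
    (S : Finset (ZMod p)) (hk : 2 * S.card + 1 = p) : S.card ≤ @d3plusCard p ⟨hp.ne_zero⟩ S :=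
  topSlice_all_of'' polyRungStar_holds hQ p hp h7 S hk

end assembly
end Summit.Parity.GeneralizedHardyLittlewood.Theorems.PrimeGapTorusCap.NearAP
/-! ## §AM (ROUND-12) THEOREM Q IN THE KERNEL: `p ∤ D_{(p-3)/2}` for every prime `p ≥ 5` — ELEMENTARY proof
(= `round12/DelannoyQ.lean` minus its copies of `binomF`, `binomF_eq_choose`, `delannoyC`, `DelannoyNonVanishing`, which §AL declares).

`D_n = Σ_t C(n,t)·C(n+t,t)` (central Delannoy).  With `p = 2n+3`:
* `C(n+t,t) ≡ (-1)^t·C(n+2,t) (mod p)` for `t ≤ n`  (`t!·C(n+t,t) = ∏_{i<t}(n+1+i)`, `t!·C(n+2,t) = ∏_{i<t}(n+2-i)`,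
  and `(n+1+i) + (n+2-i) = p`);
* `Σ_t (-1)^t C(n,t) C(n+2,t) = [X^{n+2}] (1+X)^n (X-1)^{n+2}` and `(1+X)^n (X-1)^{n+2} = (X²-1)^n (X²-2X+1)`;
* `[X^j](X²-1)^n = (-1)^{n-j/2} C(n,j/2)` (`j` even), `0` (`j` odd); hence the coefficient is
  `±(C(2s+2,s+2) - C(2s+2,s+1))` (`n = 2s+2`) resp. `∓2·C(2r+1,r+1)` (`n = 2r+1`), a unit mod `p` because `n < p`. -/

namespace Summit.Parity.GeneralizedHardyLittlewood.Theorems.PrimeGapTorusCap.NearAP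
open Finset Polynomial
section delannoyQ
/-- Binomial coefficients `C(a,b)` with `b ≤ a < p` are units mod `p`. -/
theorem choose_cast_ne_zero {p : ℕ} (hp : p.Prime) {a b : ℕ} (ha : a < p) (hb : b ≤ a) :
    ((a.choose b : ℕ) : ZMod p) ≠ 0 := by
  rw [Ne, ZMod.natCast_eq_zero_iff]
  intro h
  have h1 : p ∣ Nat.factorial a := by
    rw [← Nat.choose_mul_factorial_mul_factorial hb, mul_assoc]
    exact dvd_mul_of_dvd_left h _
  exact absurd (hp.dvd_factorial.1 h1) (by omega)

/-- The key congruence: `C(n+t,t) ≡ (-1)^t·C(n+2,t) (mod p)` for `p = 2n+3`, `t ≤ n`. -/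
theorem choose_add_cast_eq {p n t : ℕ} (hp : p = 2 * n + 3) (hpr : p.Prime) (ht : t ≤ n) :
    (((n + t).choose t : ℕ) : ZMod p) = (-1) ^ t * (((n + 2).choose t : ℕ) : ZMod p) := by
  haveI : Fact p.Prime := ⟨hpr⟩
  have htf : ((Nat.factorial t : ℕ) : ZMod p) ≠ 0 := by
    rw [Ne, ZMod.natCast_eq_zero_iff]
    intro h
    have := hpr.dvd_factorial.1 h
    omega
  have key : ((Nat.factorial t : ℕ) : ZMod p) * (((n + t).choose t : ℕ) : ZMod p)
      = ((Nat.factorial t : ℕ) : ZMod p) * ((-1) ^ t * (((n + 2).choose t : ℕ) : ZMod p)) := by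
    have e1 : ((Nat.factorial t : ℕ) : ZMod p) * (((n + t).choose t : ℕ) : ZMod p)
        = (((n + 1).ascFactorial t : ℕ) : ZMod p) := by
      rw [← Nat.cast_mul, ← Nat.ascFactorial_eq_factorial_mul_choose]
    have e2 : ((Nat.factorial t : ℕ) : ZMod p) * (((n + 2).choose t : ℕ) : ZMod p)
        = (((n + 2).descFactorial t : ℕ) : ZMod p) := by
      rw [← Nat.cast_mul, ← Nat.descFactorial_eq_factorial_mul_choose]
    rw [mul_left_comm, e2, e1, Nat.ascFactorial_eq_prod_range, Nat.descFactorial_eq_prod_range,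
      Nat.cast_prod, Nat.cast_prod]
    have hterm : ∀ i ∈ Finset.range t,
        (((n + 1 + i : ℕ)) : ZMod p) = (-1) * (((n + 2 - i : ℕ)) : ZMod p) := by
      intro i hi
      have hi' : i < t := Finset.mem_range.1 hi
      have hsum : (((n + 1 + i : ℕ)) : ZMod p) + (((n + 2 - i : ℕ)) : ZMod p) = 0 := by
        rw [← Nat.cast_add, show n + 1 + i + (n + 2 - i) = p by omega, ZMod.natCast_self]
      linear_combination hsum
    rw [Finset.prod_congr rfl hterm, Finset.prod_mul_distrib, Finset.prod_const, Finset.card_range]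
  exact mul_left_cancel₀ htf key

/-- `D_n ≡ Σ_{t ≤ n} (-1)^t C(n,t) C(n+2,t) (mod p)` for `p = 2n+3`. -/
theorem delannoy_cast_eq {p n : ℕ} (hp : p = 2 * n + 3) (hpr : p.Prime) :
    ((delannoyC n : ℕ) : ZMod p)
      = ∑ t ∈ Finset.range (n + 1), (-1 : ZMod p) ^ t * ((n.choose t : ℕ) : ZMod p) * (((n + 2).choose t : ℕ) : ZMod p) := by
  unfold delannoyC
  rw [Nat.cast_sum]
  refine Finset.sum_congr rfl fun t ht => ?_
  have ht' : t ≤ n := by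
    have := Finset.mem_range.1 ht
    omega
  rw [binomF_eq_choose, binomF_eq_choose, Nat.cast_mul, choose_add_cast_eq hp hpr ht']
  ring

end delannoyQ
end Summit.Parity.GeneralizedHardyLittlewood.Theorems.PrimeGapTorusCap.NearAP
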